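import Summits.AnomalousDissipation.AnomalousDissipation.Theses.MomentParity
import Summits.AnomalousDissipation.AnomalousDissipation.Theorems.ResolvedDissipation.Negative.LoadBearing
import Summits.AnomalousDissipation.AnomalousDissipation.Theorems.MomentParityQuarticGateBasis
import Literature.Analysis.FluidPDE.GalerkinFlow

/-!
# Anatomy of the trajectory-UI stub of crux `MomentParity.ResolvedDissipation`
# (stmt-AnomalousDissipation-14284, line `enstrophy-ui-transfer`, stub S1 `stub_trajectoryUI`)

Supports stmt-AnomalousDissipation-14284 (lead c5). Nothing here closes the item.

The registered hard stub S1 (`stub_trajectoryUI`, TUI) of the line reads: for every smooth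
divergence-free mean-zero force `f`, `ν > 0` and radius `R` there is a window `T > 0` such that for
every data-enstrophy level `G < ∞` and every `ε > 0` ONE threshold `M < ∞` works for EVERY Galerkin
order `N`: every zero-mean Galerkin mode `a` of order `N` with `‖a‖₂² ≤ R²`, `‖∇a‖² ≤ G` satisfies
`∫₀ᵀ Z(S^N_t a)·1{Z(S^N_t a) > M} dt ≤ ε` (`S^N_t = Torus.galerkinFlow ν f N t`, `Z = Torus.eGradNormSq`).
The tree theorem `TrajectoryUI.resolvedDissipation_of_trajectoryUI` (p140175) derives the crux from it.

This file calibrates the hypotheses of S1 by theorems (the analogue, for the stub, of the disprover's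
`Negative/LoadBearing` for the crux):

* Part 1 — **the free decay of a shear mode is an exact orbit of every Galerkin semiflow**
  (`galerkinFlow_zero_shearField`): with zero force, `S^N_t K_{K,a} = K_{K, e^{-4π²νK²t} a}`
  for `K ≤ N` (`K_{K,a}(x) = a cos(2πK x₂) e₁`, `Negative.shearField`), by uniqueness of the
  Galerkin ODE (`IsGalerkinODESolution.galerkinCoeffFlow_eq`) once the Galerkin vector field at a
  shear mode is identified as `-4π²νK²` times the mode (`galerkinRHS_shearField`: no self-advection,
  `Negative.integral_inner_convect_shearField`, and `ΔK = -4π²K²K`).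
* Part 2 — **the data-enstrophy bound `‖∇a‖² ≤ G` of S1 is load-bearing**
  (`not_trajectoryUI_without_enstrophyBound`): deleting it makes the statement FALSE already for
  `f = 0`: the modes `K_{K,√2}` (`‖·‖₂² = 1`) dissipate at least `e⁻¹/(2ν)` of time-integrated
  enstrophy above ANY fixed level `M` within ANY window, once `K` is large
  (`le_lintegral_indicator_shearField`: on `(0, 1/(8π²νK²))` the enstrophy stays above
  `2π²K²a²/e`).

So, together with the trivial levelwise bound (at fixed `N`, `‖∇u‖² ≤ 4π²N²‖u‖₂²` along the bounded
Galerkin orbit), the conjecture-grade content of S1 is exactly the order of quantifiers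
`∃ T ∀ G … ∃ M ∀ N`.

References: Constantin–Foias 1988 Ch. 8 (8.5)–(8.7); Robinson–Rodrigo–Sadowski 2016 Thm. 4.4
Step 1; Foias–Manley–Rosa–Temam 2001 Ch. II (6.28).
-/

noncomputable section

-- `Summit.<Summit>.<Problem>`: single-conjunct summit, the duplicate namespace segment is mandated.
set_option linter.dupNamespace false

namespace Summit.AnomalousDissipation.AnomalousDissipation.Theorems.MomentParityResolvedDissipation.TrajectoryUIAnatomy

open MeasureTheory Filter Topology Set UnitAddTorus
open scoped ENNReal InnerProductSpace RealInnerProductSpace BigOperators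
open Literature.Analysis.FunctionSpaces Literature.Analysis.FunctionSpaces.Torus
open Literature.Analysis.FluidPDE Literature.Analysis.FluidPDE.Torus
open Summit.AnomalousDissipation.AnomalousDissipation.Theorems.ResolvedDissipation.Negative

/-! ## Part 1 — shear modes under the Galerkin semiflow with zero force -/

/-- A shear mode `K_{K,a}` of frequency `K ≤ N` is a Galerkin mode of order `N`. [folklore] -/
theorem isGalerkinMode_shearField {K N : ℕ} (hKN : K ≤ N) (a : ℝ) : IsGalerkinMode N (shearField K a) := by
  refine ⟨isSmooth_shearField K a, isDivFree_shearField K a, fun k hk => ?_⟩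
  refine mFourierCoeff_shearField_eq_zero a fun hkS => ?_
  rw [freqNormSq_of_mem_shearSet hkS] at hk
  have h : ((K : ℝ)) ^ 2 ≤ (N : ℝ) ^ 2 := by
    have : (K : ℝ) ≤ N := by exact_mod_cast hKN
    exact pow_le_pow_left₀ (Nat.cast_nonneg K) this 2
  exact absurd hk (not_lt.2 h)

/-- Fourier coefficients of a rescaled shear mode: `(K_{K,ra})^|_S = r • (K_{K,a})^|_S`. [folklore] -/
theorem fourierRestrict_shearField_mul (S : Finset (Fin 3 → ℤ)) (K : ℕ) (r a : ℝ) :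
    fourierRestrict S (shearField K (r * a)) = r • fourierRestrict S (shearField K a) := by
  funext k
  have hfun : shearField K (r * a) = fun x => r • shearField K a x := funext (shearField_mul K r a)
  rw [fourierRestrict_apply, Pi.smul_apply, fourierRestrict_apply, hfun,
    MomentParityQuarticGate.mFourierCoeff_complexify_smul, Complex.coe_smul]

/-- Real scalars come out of the real part of the complex inner product:
`Re⟪r • v, w⟫ = r · Re⟪v, w⟫`. [folklore] -/
theorem re_inner_real_smul_left' (r : ℝ) (v w : EuclideanSpace ℂ (Fin 3)) :
    (inner ℂ (r • v) w).re = r * (inner ℂ v w).re := by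
  rw [← Complex.coe_smul, inner_smul_left, Complex.conj_ofReal, Complex.re_ofReal_mul]

/-- **The Galerkin vector field at a shear mode (zero force) is `-4π²νK²` times the mode.**
For `K ≤ N` and every amplitude `a`,
`galerkinRHS (freqBall N) ν 0̂ (K_{K,a})^ = -(ν·4π²K²) • (K_{K,a})^`: tested against any Galerkin
mode `b` of order `N`, the master identity `sum_re_inner_galerkinField_test` gives
`∫ ⟪K,(K·∇)b⟫ + ν⟪K, Δb⟫ + ⟪P_N 0, b⟫ = -4π²νK² ∫⟪K, b⟫` (no self-advection, `ΔK = -4π²K²K`);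
test with the residual. [folklore] -/
theorem galerkinRHS_shearField (ν : ℝ) {K N : ℕ} (hKN : K ≤ N) (a : ℝ) :
    galerkinRHS (freqBall N) ν (fourierRestrict (freqBall N) (0 : T3 → R3))
        (fourierRestrict (freqBall N) (shearField K a)) =
      (-(ν * (4 * Real.pi ^ 2 * (K : ℝ) ^ 2))) • fourierRestrict (freqBall N) (shearField K a) := by
  set S : Finset (Fin 3 → ℤ) := freqBall N with hSdef
  have hS : ∀ k ∈ S, -k ∈ S := neg_mem_freqBall_of_mem
  set U : T3 → R3 := shearField K a with hUdef
  have hU : IsGalerkinMode N U := isGalerkinMode_shearField hKN a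
  set c : ↥S → EuclideanSpace ℂ (Fin 3) := fourierRestrict S U with hcdef
  set g : ↥S → EuclideanSpace ℂ (Fin 3) := fourierRestrict S (0 : T3 → R3) with hgdef
  have hc : c ∈ galerkinSubspace S := hU.fourierRestrict_mem
  have h0i : Integrable (0 : T3 → R3) volume := integrable_zero _ _ _
  have h0m : MemLp (0 : T3 → R3) 2 volume := MemLp.zero
  have hg : IsRealCoeff g := isRealCoeff_mFourierCoeff h0i
  set lam : ℝ := ν * (4 * Real.pi ^ 2 * (K : ℝ) ^ 2) with hlam
  -- the residual
  set V : ↥S → EuclideanSpace ℂ (Fin 3) := galerkinRHS S ν g c + lam • c with hVdef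
  have hVmem : V ∈ galerkinSubspace S :=
    (galerkinSubspace S).add_mem (galerkinRHS_mem ν hS hg hc) ((galerkinSubspace S).smul_mem lam hc)
  have hVk : ∀ k : ↥S, V k = galerkinRHS S ν g c k + lam • c k := fun k => rfl
  -- the test field of the residual
  set b : T3 → R3 := realTrigPoly S (coeffExt S V) with hbdef
  have hb : IsGalerkinMode N b := isGalerkinMode_realTrigPoly_coeffExt hVmem
  have hband : ∀ k ∉ S, mFourierCoeff (EuclideanSpace.complexify ∘ b) k = 0 :=
    fun k hk => hb.mFourierCoeff_eq_zero (not_mem_freqBall.1 hk)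
  have hbhat : ∀ k ∈ S, mFourierCoeff (EuclideanSpace.complexify ∘ b) k = coeffExt S V k := by
    intro k hk
    rw [hbdef, mFourierCoeff_realTrigPoly hS (hVmem.1.isConjSymm_coeffExt hS), if_pos hk]
  -- master identity I at the test field `b`
  have hid := sum_re_inner_galerkinField_test ν hS (hg.isConjSymm_coeffExt hS)
    (hc.1.isConjSymm_coeffExt hS) hc.2.isTransversal_coeffExt hb.isSmooth hb.isDivFree hband
  have hUeq : realTrigPoly S (coeffExt S c) = U := hU.realTrigPoly_fourierRestrict
  have hGeq : realTrigPoly S (coeffExt S g) = fourierTruncate N (0 : T3 → R3) :=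
    realTrigPoly_coeffExt_fourierRestrict N (0 : T3 → R3)
  rw [hUeq, hGeq] at hid
  -- evaluate the three terms of the right-hand side
  have hbs : IsSmooth b := hb.isSmooth
  have hconv : ∫ x, ⟪U x, convect U b x⟫_ℝ = 0 := integral_inner_convect_shearField K a hbs
  have hlap : ∫ x, ⟪U x, laplacian b x⟫_ℝ = -(4 * Real.pi ^ 2 * (K : ℝ) ^ 2) * ∫ x, ⟪U x, b x⟫_ℝ :=
    integral_inner_laplacian_shearField K a hbs
  have hforce : ∫ x, ⟪fourierTruncate N (0 : T3 → R3) x, b x⟫_ℝ = 0 := by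
    rw [integral_inner_fourierTruncate_eq h0m (hbs.memLp 2) hband]
    simp
  have hUs : IsSmooth U := hU.isSmooth
  have i1 : Integrable (fun x => ⟪U x, convect U b x⟫_ℝ) volume := (hUs.inner (hUs.convect hbs)).integrable
  have i2 : Integrable (fun x => ν * ⟪U x, laplacian b x⟫_ℝ) volume :=
    ((hUs.inner hbs.laplacian).integrable).const_mul ν
  have i12 : Integrable (fun x => ⟪U x, convect U b x⟫_ℝ + ν * ⟪U x, laplacian b x⟫_ℝ) volume := i1.add i2
  have i3 : Integrable (fun x => ⟪fourierTruncate N (0 : T3 → R3) x, b x⟫_ℝ) volume :=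
    ((isSmooth_fourierTruncate N (0 : T3 → R3)).inner hbs).integrable
  have hrhs : ∫ x, (⟪U x, convect U b x⟫_ℝ + ν * ⟪U x, laplacian b x⟫_ℝ +
      ⟪fourierTruncate N (0 : T3 → R3) x, b x⟫_ℝ) = -lam * ∫ x, ⟪U x, b x⟫_ℝ := by
    rw [integral_add i12 i3, integral_add i1 i2, integral_const_mul, hconv, hlap, hforce, hlam]
    ring
  rw [hrhs] at hid
  -- Parseval for `∫⟪U, b⟫`
  have hpar : ∫ x, ⟪U x, b x⟫_ℝ =
      ∑ k ∈ S, (inner ℂ (coeffExt S c k) (mFourierCoeff (EuclideanSpace.complexify ∘ b) k)).re := by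
    rw [← hUeq]
    exact integral_inner_realTrigPoly_left hS (hc.1.isConjSymm_coeffExt hS) (hbs.memLp 2)
  rw [hpar] at hid
  -- hence `∑ ‖V k‖² = ∑_k Re⟪V k, b̂ k⟫ = 0`
  have hid' : ∑ k ∈ S, (inner ℂ (galerkinField ν S (coeffExt S g) (coeffExt S c) k)
      (mFourierCoeff (EuclideanSpace.complexify ∘ b) k)).re +
      lam * ∑ k ∈ S, (inner ℂ (coeffExt S c k) (mFourierCoeff (EuclideanSpace.complexify ∘ b) k)).re = 0 := by
    rw [hid]; ring
  have hsum : ∑ k : ↥S, ‖V k‖ ^ 2 =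
      ∑ k ∈ S, (inner ℂ (galerkinField ν S (coeffExt S g) (coeffExt S c) k)
        (mFourierCoeff (EuclideanSpace.complexify ∘ b) k)).re +
      lam * ∑ k ∈ S, (inner ℂ (coeffExt S c k) (mFourierCoeff (EuclideanSpace.complexify ∘ b) k)).re := by
    rw [Finset.mul_sum, ← Finset.sum_add_distrib, ← Finset.sum_coe_sort S]
    refine Finset.sum_congr rfl fun k _ => ?_
    rw [hbhat _ k.2, coeffExt_coe, coeffExt_coe, ← galerkinRHS_apply, ← re_inner_real_smul_left',
      ← Complex.add_re, ← inner_add_left, ← hVk k, ← RCLike.re_to_complex, inner_self_eq_norm_sq]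
  rw [hid'] at hsum
  have hzero : ∀ k : ↥S, V k = 0 := fun k => by
    have hk := (Finset.sum_eq_zero_iff_of_nonneg fun k _ => sq_nonneg ‖V k‖).1 hsum k (Finset.mem_univ k)
    rwa [sq_eq_zero_iff, norm_eq_zero] at hk
  have hV0 : galerkinRHS S ν g c + lam • c = 0 := funext hzero
  -- read off the field
  rw [neg_smul]
  exact eq_neg_of_add_eq_zero_left hV0

/-- **Free decay of a shear mode is the Galerkin orbit** (zero force, any `ν`, `K ≤ N`):
`Torus.galerkinFlow ν 0 N t K_{K,a} = K_{K, exp(-4π²νK² t)·a}` for `t ≥ 0`. The rescaled curve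
`t ↦ e^{-4π²νK²t} (K_{K,a})^` solves the Galerkin ODE (`galerkinRHS_shearField` at every amplitude), so it
IS the orbit by uniqueness (`IsGalerkinODESolution.galerkinCoeffFlow_eq`). [folklore] -/
theorem galerkinFlow_zero_shearField (ν : ℝ) {K N : ℕ} (hKN : K ≤ N) (a : ℝ) {t : ℝ} (ht : 0 ≤ t) :
    Torus.galerkinFlow ν (0 : T3 → R3) N t (shearField K a) =
      shearField K (Real.exp (-(ν * (4 * Real.pi ^ 2 * (K : ℝ) ^ 2)) * t) * a) := by
  set lam : ℝ := ν * (4 * Real.pi ^ 2 * (K : ℝ) ^ 2) with hlam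
  have hU : IsGalerkinMode N (shearField K a) := isGalerkinMode_shearField hKN a
  have hc : fourierRestrict (freqBall N) (shearField K a) ∈ galerkinSubspace (freqBall N) :=
    hU.fourierRestrict_mem
  -- the explicit curve and its derivative
  have hβc : ∀ s, Real.exp (-lam * s) • fourierRestrict (freqBall N) (shearField K a) =
      fourierRestrict (freqBall N) (shearField K (Real.exp (-lam * s) * a)) := fun s => by
    rw [fourierRestrict_shearField_mul]
  have hderiv : ∀ s, HasDerivAt (fun s => Real.exp (-lam * s) • fourierRestrict (freqBall N) (shearField K a))
      ((-lam * Real.exp (-lam * s)) • fourierRestrict (freqBall N) (shearField K a)) s := fun s => by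
    have h1 : HasDerivAt (fun s => -lam * s) (-lam) s := by
      simpa using (hasDerivAt_id s).const_mul (-lam)
    exact (h1.exp.smul_const (fourierRestrict (freqBall N) (shearField K a))).congr_deriv (by rw [mul_comm])
  have hrhs : ∀ s, galerkinRHS (freqBall N) ν (fourierRestrict (freqBall N) (0 : T3 → R3))
      (Real.exp (-lam * s) • fourierRestrict (freqBall N) (shearField K a)) =
      (-lam * Real.exp (-lam * s)) • fourierRestrict (freqBall N) (shearField K a) := fun s => by
    rw [hβc s, galerkinRHS_shearField ν hKN, fourierRestrict_shearField_mul, smul_smul]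
  have hsol : IsGalerkinODESolution ν (fourierRestrict (freqBall N) (0 : T3 → R3))
      (fourierRestrict (freqBall N) (shearField K a))
      (fun s => Real.exp (-lam * s) • fourierRestrict (freqBall N) (shearField K a)) :=
    ⟨by simp, fun s => (galerkinSubspace (freqBall N)).smul_mem _ hc,
      ((Real.continuous_exp.comp (continuous_const.mul continuous_id)).smul continuous_const).continuousOn,
      fun T s _ => by rw [hrhs s]; exact (hderiv s).hasDerivWithinAt⟩
  rw [hU.galerkinFlow_eq, hsol.galerkinCoeffFlow_eq ht]
  -- `hsol.galerkinCoeffFlow_eq` leaves the curve applied at `t`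
  show realTrigPoly (freqBall N) (coeffExt (freqBall N)
      (Real.exp (-lam * t) • fourierRestrict (freqBall N) (shearField K a))) = _
  rw [hβc t]
  exact (isGalerkinMode_shearField hKN _).realTrigPoly_fourierRestrict

/-- The enstrophy along the free decay of a shear mode: `‖∇S^N_t K_{K,a}‖² = 2π²K² (e^{-4π²νK²t} a)²`
(`0 < K ≤ N`, `t ≥ 0`). [folklore] -/
theorem eGradNormSq_galerkinFlow_zero_shearField (ν : ℝ) {K N : ℕ} (hK : K ≠ 0) (hKN : K ≤ N) (a : ℝ)
    {t : ℝ} (ht : 0 ≤ t) :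
    Torus.eGradNormSq (Torus.galerkinFlow ν (0 : T3 → R3) N t (shearField K a)) =
      ENNReal.ofReal (2 * Real.pi ^ 2 * (K : ℝ) ^ 2 *
        (Real.exp (-(ν * (4 * Real.pi ^ 2 * (K : ℝ) ^ 2)) * t) * a) ^ 2) := by
  rw [galerkinFlow_zero_shearField ν hKN a ht, eGradNormSq_shearField hK]

/-! ## Part 2 — the data-enstrophy bound of S1 is load-bearing -/

/-- **Lower bound for the high-level time-integrated enstrophy of a decaying shear mode.** For `ν > 0`,
`0 < K ≤ N`, a window `T ≥ 1/(8π²νK²)` and a level `M < 2π²K²a²/e`: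
`a² e⁻¹/(4ν) ≤ ∫₀ᵀ Z(S^N_t K_{K,a}) 1{Z > M} dt` (`Z = Torus.eGradNormSq`, zero force): on
`(0, 1/(8π²νK²))` the enstrophy `2π²K²a² e^{-8π²νK²t}` stays above `2π²K²a²/e > M`. [folklore] -/
theorem le_lintegral_indicator_shearField {ν : ℝ} (hν : 0 < ν) {K N : ℕ} (hK : K ≠ 0) (hKN : K ≤ N)
    (a : ℝ) {T : ℝ} (hT : 1 / (8 * Real.pi ^ 2 * ν * (K : ℝ) ^ 2) ≤ T) {M : ℝ≥0∞}
    (hM : M < ENNReal.ofReal (2 * Real.pi ^ 2 * (K : ℝ) ^ 2 * a ^ 2 * Real.exp (-1))) :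
    ENNReal.ofReal (a ^ 2 * Real.exp (-1) / (4 * ν)) ≤
      ∫⁻ t in Ioo 0 T, (Ioi M).indicator id
        (Torus.eGradNormSq (Torus.galerkinFlow ν (0 : T3 → R3) N t (shearField K a))) := by
  have hKpos : (0 : ℝ) < K := by exact_mod_cast Nat.pos_of_ne_zero hK
  have hK2 : (0 : ℝ) < (K : ℝ) ^ 2 := by positivity
  set lam : ℝ := ν * (4 * Real.pi ^ 2 * (K : ℝ) ^ 2) with hlam
  have hlam0 : 0 < lam := by positivity
  set t₁ : ℝ := 1 / (8 * Real.pi ^ 2 * ν * (K : ℝ) ^ 2) with ht₁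
  have ht₁0 : 0 < t₁ := by positivity
  have ht₁lam : 2 * lam * t₁ = 1 := by
    rw [hlam, ht₁]; field_simp; ring
  set Z₁ : ℝ := 2 * Real.pi ^ 2 * (K : ℝ) ^ 2 * a ^ 2 * Real.exp (-1) with hZ₁
  -- pointwise lower bound on `(0, t₁)`
  have hpt : ∀ t ∈ Ioo (0 : ℝ) t₁, ENNReal.ofReal Z₁ ≤ (Ioi M).indicator id
      (Torus.eGradNormSq (Torus.galerkinFlow ν (0 : T3 → R3) N t (shearField K a))) := by
    intro t ht
    have hZt := eGradNormSq_galerkinFlow_zero_shearField ν hK hKN a ht.1.le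
    have hexp : Real.exp (-1) ≤ (Real.exp (-lam * t)) ^ 2 := by
      rw [← Real.exp_nat_mul]
      refine Real.exp_le_exp.2 ?_
      have : 2 * lam * t ≤ 1 := by
        rw [← ht₁lam]; exact mul_le_mul_of_nonneg_left ht.2.le (by positivity)
      push_cast; linarith
    have hle : Z₁ ≤ 2 * Real.pi ^ 2 * (K : ℝ) ^ 2 * (Real.exp (-lam * t) * a) ^ 2 := by
      rw [hZ₁, mul_pow]
      have h0 : 0 ≤ 2 * Real.pi ^ 2 * (K : ℝ) ^ 2 * a ^ 2 := by positivity
      nlinarith [h0, hexp, sq_nonneg a]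
    rw [hlam] at hle
    have hZle : ENNReal.ofReal Z₁ ≤
        Torus.eGradNormSq (Torus.galerkinFlow ν (0 : T3 → R3) N t (shearField K a)) := by
      rw [hZt]
      exact ENNReal.ofReal_le_ofReal hle
    have hmem : Torus.eGradNormSq (Torus.galerkinFlow ν (0 : T3 → R3) N t (shearField K a)) ∈ Ioi M :=
      lt_of_lt_of_le hM hZle
    rw [indicator_of_mem hmem, id]
    exact hZle
  -- integrate the constant over `(0, t₁) ⊆ (0, T)`
  calc ENNReal.ofReal (a ^ 2 * Real.exp (-1) / (4 * ν))
      = ENNReal.ofReal Z₁ * ENNReal.ofReal t₁ := by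
        rw [← ENNReal.ofReal_mul (by positivity)]
        congr 1
        rw [hZ₁, ht₁]; field_simp; ring
    _ = ∫⁻ _ in Ioo 0 t₁, ENNReal.ofReal Z₁ := by
        rw [setLIntegral_const, Real.volume_Ioo, sub_zero]
    _ ≤ ∫⁻ t in Ioo 0 t₁, (Ioi M).indicator id
          (Torus.eGradNormSq (Torus.galerkinFlow ν (0 : T3 → R3) N t (shearField K a))) :=
        setLIntegral_mono' measurableSet_Ioo hpt
    _ ≤ ∫⁻ t in Ioo 0 T, (Ioi M).indicator id
          (Torus.eGradNormSq (Torus.galerkinFlow ν (0 : T3 → R3) N t (shearField K a))) :=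
        lintegral_mono_set (Ioo_subset_Ioo_right hT)

/-- **Witness family**: for `ν > 0`, `a ≠ 0`, every window `T > 0` and every finite level `M` there is a
frequency `K ≠ 0` such that at every order `N ≥ K` the freely decaying shear mode `K_{K,a}` has
`a² e⁻¹/(4ν) ≤ ∫₀ᵀ Z 1{Z > M}`. [folklore] -/
theorem exists_shearField_witness {ν : ℝ} (hν : 0 < ν) {a : ℝ} (ha : a ≠ 0) {T : ℝ} (hT : 0 < T)
    {M : ℝ≥0∞} (hM : M ≠ ⊤) :
    ∃ K : ℕ, K ≠ 0 ∧ ∀ N : ℕ, K ≤ N →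
      ENNReal.ofReal (a ^ 2 * Real.exp (-1) / (4 * ν)) ≤
        ∫⁻ t in Ioo 0 T, (Ioi M).indicator id
          (Torus.eGradNormSq (Torus.galerkinFlow ν (0 : T3 → R3) N t (shearField K a))) := by
  -- choose `K ≥ 1` with `K ≥ 1/(8π²νT)` and `2π²K²a²/e > M.toReal`
  obtain ⟨K, hK⟩ := exists_nat_gt (max 1 (max (1 / (8 * Real.pi ^ 2 * ν * T))
    (M.toReal / (2 * Real.pi ^ 2 * a ^ 2 * Real.exp (-1)))))
  have hK1 : (1 : ℝ) < K := lt_of_le_of_lt (le_max_left _ _) hK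
  have hKT : 1 / (8 * Real.pi ^ 2 * ν * T) < K :=
    lt_of_le_of_lt ((le_max_left _ _).trans (le_max_right _ _)) hK
  have hKM : M.toReal / (2 * Real.pi ^ 2 * a ^ 2 * Real.exp (-1)) < K :=
    lt_of_le_of_lt ((le_max_right _ _).trans (le_max_right _ _)) hK
  have hKne : K ≠ 0 := by
    rintro rfl; norm_num at hK1
  have hKsq : (K : ℝ) ≤ (K : ℝ) ^ 2 := by nlinarith
  have ha2 : 0 < a ^ 2 := by positivity
  have hc0 : 0 < 2 * Real.pi ^ 2 * a ^ 2 * Real.exp (-1) := by positivity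
  refine ⟨K, hKne, fun N hKN => le_lintegral_indicator_shearField hν hKne hKN a ?_ ?_⟩
  · -- the window condition `1/(8π²νK²) ≤ T`
    have hden : 0 < 8 * Real.pi ^ 2 * ν * T := by positivity
    have h1 : 1 < 8 * Real.pi ^ 2 * ν * T * K := by
      have := (div_lt_iff₀ hden).1 hKT
      linarith
    rw [div_le_iff₀ (by positivity)]
    nlinarith [mul_le_mul_of_nonneg_left hKsq hden.le]
  · -- the level condition `M < 2π²K²a²/e`
    rw [← ENNReal.ofReal_toReal hM]
    refine (ENNReal.ofReal_lt_ofReal_iff (by positivity)).2 ?_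
    have h1 : M.toReal < K * (2 * Real.pi ^ 2 * a ^ 2 * Real.exp (-1)) := by
      rwa [div_lt_iff₀ hc0] at hKM
    nlinarith [mul_le_mul_of_nonneg_right hKsq hc0.le]

/-- **The data-enstrophy bound of S1 is load-bearing: TUI without `‖∇a‖² ≤ G` is FALSE.** The displayed
statement is the registered signature of `stub_trajectoryUI` with the level quantifier `∀ G ≠ ⊤` and the
hypothesis `Torus.eGradNormSq a ≤ G` deleted; it fails at `f = 0`, `ν = 1`, `R = 1` on the freely
decaying shear modes `K_{K,√2}` (`‖·‖₂² = 1`, zero mean, Galerkin modes of every order `N ≥ K`), which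
dissipate `≥ e⁻¹/2` of time-integrated enstrophy above every fixed level inside every window as
`K → ∞` (`exists_shearField_witness`). [folklore] -/
theorem not_trajectoryUI_without_enstrophyBound :
    ¬ (∀ f : UnitAddTorus (Fin 3) → EuclideanSpace ℝ (Fin 3),
        Torus.IsSmooth f → Torus.IsDivFree f → Torus.HasZeroMean f →
        ∀ ν : ℝ, 0 < ν → ∀ R : ℝ, ∃ T : ℝ, 0 < T ∧
          ∀ ε : ℝ≥0∞, 0 < ε → ∃ M : ℝ≥0∞, M ≠ ⊤ ∧
            ∀ (N : ℕ) (a : UnitAddTorus (Fin 3) → EuclideanSpace ℝ (Fin 3)),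
              IsGalerkinMode N a → Torus.HasZeroMean a → ∫ x, ‖a x‖ ^ 2 ≤ R ^ 2 →
              ∫⁻ t in Set.Ioo 0 T, (Set.Ioi M).indicator id
                  (Torus.eGradNormSq (Torus.galerkinFlow ν f N t a)) ≤ ε) := by
  intro h
  obtain ⟨T, hT, hε⟩ := h 0 isSmooth_zero isDivFree_zero hasZeroMean_zero 1 one_pos 1
  -- tolerance `ε = e⁻¹/4 < e⁻¹/2`
  have hεpos : (0 : ℝ≥0∞) < ENNReal.ofReal (Real.exp (-1) / 4) := ENNReal.ofReal_pos.2 (by positivity)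
  obtain ⟨M, hM, hb⟩ := hε _ hεpos
  have ha : Real.sqrt 2 ≠ 0 := by positivity
  obtain ⟨K, hK, hw⟩ := exists_shearField_witness one_pos ha hT hM
  have hmode : IsGalerkinMode K (shearField K (Real.sqrt 2)) := isGalerkinMode_shearField le_rfl _
  have hmean : Torus.HasZeroMean (shearField K (Real.sqrt 2)) := hasZeroMean_shearField hK _
  have hnorm : ∫ x, ‖shearField K (Real.sqrt 2) x‖ ^ 2 ≤ (1 : ℝ) ^ 2 := by
    rw [integral_norm_sq_shearField hK, Real.sq_sqrt (by norm_num)]; norm_num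
  have hup := hb K (shearField K (Real.sqrt 2)) hmode hmean hnorm
  have hlow := hw K le_rfl
  rw [Real.sq_sqrt (by norm_num : (0 : ℝ) ≤ 2)] at hlow
  have hlt : ENNReal.ofReal (Real.exp (-1) / 4) < ENNReal.ofReal (2 * Real.exp (-1) / (4 * 1)) := by
    refine (ENNReal.ofReal_lt_ofReal_iff (by positivity)).2 ?_
    have := Real.exp_pos (-1)
    linarith
  exact absurd (hlow.trans hup) (not_le.2 hlt)

/-! ## Registered tools stub -/

/-- **Registered tools stub `stub_trajectoryUIAnatomy` of stmt-AnomalousDissipation-14284** (line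
`enstrophy-ui-transfer`; `ledger workitem stub-add … --name stub_trajectoryUIAnatomy`): the conjunction of
the two results of this file — (i) the free decay of shear modes is the Galerkin orbit at zero force,
(ii) the registered hard stub S1 `stub_trajectoryUI` with its data-enstrophy bound deleted is false. [folklore] -/
theorem stub_trajectoryUIAnatomy :
    (∀ (ν : ℝ) (K N : ℕ), K ≤ N → ∀ (a t : ℝ), 0 ≤ t →
      Literature.Analysis.FluidPDE.Torus.galerkinFlow ν
          (0 : UnitAddTorus (Fin 3) → EuclideanSpace ℝ (Fin 3)) N t
          (Summit.AnomalousDissipation.AnomalousDissipation.Theorems.ResolvedDissipation.Negative.shearField K a) =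
        Summit.AnomalousDissipation.AnomalousDissipation.Theorems.ResolvedDissipation.Negative.shearField K
          (Real.exp (-(ν * (4 * Real.pi ^ 2 * (K : ℝ) ^ 2)) * t) * a)) ∧
    ¬ (∀ f : UnitAddTorus (Fin 3) → EuclideanSpace ℝ (Fin 3),
        Literature.Analysis.FunctionSpaces.Torus.IsSmooth f →
        Literature.Analysis.FunctionSpaces.Torus.IsDivFree f →
        Literature.Analysis.FunctionSpaces.Torus.HasZeroMean f →
        ∀ ν : ℝ, 0 < ν → ∀ R : ℝ, ∃ T : ℝ, 0 < T ∧
          ∀ ε : ENNReal, 0 < ε → ∃ M : ENNReal, M ≠ ⊤ ∧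
            ∀ (N : ℕ) (a : UnitAddTorus (Fin 3) → EuclideanSpace ℝ (Fin 3)),
              Literature.Analysis.FluidPDE.IsGalerkinMode N a →
              Literature.Analysis.FunctionSpaces.Torus.HasZeroMean a → ∫ x, ‖a x‖ ^ 2 ≤ R ^ 2 →
              ∫⁻ t in Set.Ioo 0 T, (Set.Ioi M).indicator id
                  (Literature.Analysis.FunctionSpaces.Torus.eGradNormSq
                    (Literature.Analysis.FluidPDE.Torus.galerkinFlow ν f N t a)) ≤ ε) :=
  ⟨fun ν _ _ hKN a _ ht => galerkinFlow_zero_shearField ν hKN a ht, not_trajectoryUI_without_enstrophyBound⟩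

end Summit.AnomalousDissipation.AnomalousDissipation.Theorems.MomentParityResolvedDissipation.TrajectoryUIAnatomy

end
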